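import Summits.CriticalPhenomena.PercolationContinuityZ3.Theorems.PercNearOneGluingNoHeavyPcintWinKernelNF
import HarnessLib

/-!
# PCINT lane, kernel window certificates — normal forms enumerated by prefix (a cover of `nfCodes` by small blocks)

Cell `prim-pcint`, seat `prim-pcint-2` (gen 2); memo `run/shared/lean/prim/pcint/EFFICIENCY.md` §4, INTERVAL-PLAN §15.
Does NOT build on p205010.  `WinK.nfCodesIn` (`…PcintWinKernelNF`) selects a code range by FILTERING the whole list
`nfCodes d n`; for `d = 3`, 8-step windows (39168 normal forms) that traversal alone costs ≈ 60 s of kernel time and most of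
the kernel's memory budget per declaration.  Here a block is instead the set of normal forms EXTENDING A PREFIX:
* `nfCodesP d n k pre` — codes of `pre ++ l` for the continuations `l ∈ nfLists d k (n - |pre|)` (`k` = scan state after `pre`);
  `all_nfCodes_of_nfCodesP`: the empty prefix gives `nfCodes d n`;
* `all_nfCodesP_of_cover` — one unfolding of `nfLists`: the block of `pre` is covered by the blocks of its admitted
  one-step extensions `pre ++ [a]`, `a ∈ nfNext d k` (the list of children is supplied explicitly and checked by `decide`);
* `all_cons_of` — assembling `List.all` over an explicit list of children from one fact per child.
An instance proves one `decide +kernel` fact per leaf prefix (≤ a few hundred rows each, no global enumeration) and climbs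
the prefix tree with `all_nfCodesP_of_cover`.
-/

namespace Summit.CriticalPhenomena.PercolationContinuityZ3.Theorems.Pcint

namespace WinK

/-- Codes of the normal-form step lists of length `n` that extend the prefix `pre` (scan state `k` after `pre`). [folklore] -/
def nfCodesP (d n k : ℕ) (pre : List (Fin d × Bool)) : List ℕ :=
  (nfLists d k (n - pre.length)).map fun l => encL d (pre ++ l)

/-- The block of the empty prefix is `nfCodes`. [folklore] -/
theorem all_nfCodes_of_nfCodesP {d n : ℕ} {f : ℕ → Bool} (h : (nfCodesP d n 0 []).all f = true) :
    (nfCodes d n).all f = true := by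
  rw [List.all_eq_true] at h ⊢
  intro c hc
  unfold nfCodes at hc
  obtain ⟨l, hl, rfl⟩ := List.mem_map.1 hc
  apply h
  unfold nfCodesP
  exact List.mem_map.2 ⟨l, by simpa using hl, by simp⟩

/-- **Cover step**: the block of a proper prefix is covered by the blocks of its admitted one-step extensions
(children list `ch` given explicitly, checked against `nfNext`). [folklore] -/
theorem all_nfCodesP_of_cover {d n k : ℕ} {pre : List (Fin d × Bool)} {f : ℕ → Bool}
    (ch : List (ℕ × List (Fin d × Bool)))
    (hch : ((nfNext d k).map fun a => ((if (a.1 : ℕ) = k then k + 1 else k), pre ++ [a])) = ch)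
    (hlen : pre.length < n) (h : ch.all (fun c => (nfCodesP d n c.1 c.2).all f) = true) :
    (nfCodesP d n k pre).all f = true := by
  subst hch
  rw [List.all_eq_true] at h ⊢
  intro c hc
  unfold nfCodesP at hc
  obtain ⟨l, hl, rfl⟩ := List.mem_map.1 hc
  obtain ⟨m, hm⟩ : ∃ m, n - pre.length = m + 1 := ⟨n - pre.length - 1, by omega⟩
  rw [hm, nfLists, List.mem_flatMap] at hl
  obtain ⟨a, ha, hl⟩ := hl
  obtain ⟨l', hl', rfl⟩ := List.mem_map.1 hl
  have hc0 := h _ (List.mem_map.2 ⟨a, ha, rfl⟩)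
  dsimp only at hc0
  rw [List.all_eq_true] at hc0
  apply hc0
  unfold nfCodesP
  refine List.mem_map.2 ⟨l', ?_, by rw [List.append_assoc, List.singleton_append]⟩
  have e : n - (pre ++ [a]).length = m := by rw [List.length_append, List.length_singleton]; omega
  rw [e]; exact hl'

/-- `List.all` over an explicit list, one fact per element. [folklore] -/
theorem all_cons_of {α : Type*} {p : α → Bool} {a : α} {l : List α} (h₁ : p a = true) (h₂ : l.all p = true) :
    (a :: l).all p = true := by
  rw [List.all_cons, h₁, h₂]; rfl

end WinK

end Summit.CriticalPhenomena.PercolationContinuityZ3.Theorems.Pcint
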